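import Summits.QuantumFields.BalabanUV.Beta.FP.PerfectObjectsT

/-!
# `BalabanUV.Beta.FP.StationarityK` — road «FP» for binder row D1, leaf N1 (K-half, AT THE LIMIT): the fixed-point property
# `dec Lc (KPerf … (m+1)) ≃units KPerf … m` of the perfect resolvents, from the finite-level stationarity `PerfectObjects.KTot_shift`
# by an INDEX SHIFT UNDER THE CONSTRUCTED LIMIT (unconditional) and the commutation of the block-contour decimation `dec` with
# entrywise limits (finite sums — under ENTRYWISE CONVERGENCE of the (j, m+1)-family, i.e. X1m's output, never assumed away)

HONEST FRAMING (cell contract, verbatim): «discharging `BetaPertH` makes Bałaban's UV stability UNCONDITIONAL — a real constructive-QFT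
result; it is NOT the continuum limit and NOT the Clay problem.»  THIS MODULE DISCHARGES NOTHING: it is [folklore] plumbing about the
constructed entrywise limit `HessKerDressedLimit.limMKerOf` (= `limUnder atTop` entry by entry), the decimation `OneStepKernelFamily.dec`
(a finite weighted sum of entries) and the leg units `HessKerDressedUnits.unitK`, composed BY NAME with `FP.PerfectObjects.KTot_shift`
(p207092) and the typer's `FP.PerfectObjectsT.KPerf` (p207437).  Skeleton `HOME/beta/skeletons/D1-b2b-balaban-beta-d1-p3.md` §3 N1
(«`dec Lc (KPerf Lc (m+1)) ≃units KPerf Lc m` … the limit of the SHIFTED sequence is the same limit … SIZE S (K)»); claim table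
`HOME/b2b-balaban-beta-d1-p3/LEAVES-FP.md` row N1-K∞ (unit `b2b-balaban-beta-d1-formalise-leaf-06`).  The JETS half of N1 (row N1-J)
is NOT touched.  NOT BetaPertH, NOT continuum, NOT Clay.

ABSOLUTE RULE (cell, verbatim): «No internally-minted statement may enter as a cited fact. Every hypothesis is either kernel-proved in this
package or a verbatim quotation of a PUBLISHED theorem with page reference.»  Nothing is cited; no `def … : Prop`; no binder instantiated.

CONTENT (all [folklore] / [our object]).
* §1 `lim_add`/`limMKerOf_add`/`limMKerOf_succ` (+ `limStOf_succ`, `limTabOf_succ`): the constructed limit of `j ↦ K (j + k)` IS that of `K` —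
  UNCONDITIONALLY (`Filter.map_add_atTop_eq_nat`; no convergence needed).  This is the «index shift under the limit» of leaf N1 (K and J).
* §2 `dec_scaleK`/`dec_unitK`: decimation commutes with leg-type-constant units; `unitK_unitK` (units compose multiplicatively);
  `tendsto_dec_apply`/`limMKerOf_dec_of_tendsto`/`dec_limMKerOf_of_exists_tendsto`: `dec` commutes with entrywise limits of CONVERGENT
  families (finite sums: `tendsto_finsetSum`); `limMKerOf_unitK_of_exists_tendsto`: constant units pull out of convergent limits.
* §3 THE FIXED-POINT PROPERTY OF THE PERFECT RESOLVENTS.  `KPerf_succ` (`rfl`-unfolding with the exponent written `j + m + 1`);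
  **`dec_KPerf_succ`**: under entrywise convergence of the unit-rescaled (j, m+1)-family,
  `dec Lc (KPerf Lc sf sm (m+1)) = KPerf Lc (fun i => sf (i-1)) (fun i => sm (i-1)) m` (the (j+1, m)-family read in the level-`j` units);
  **`dec_KPerf_succ_of_geometric`**: for GEOMETRIC units `sf (j+1) = rf·sf j`, `sm (j+1) = rm·sm j` (`rf, rm ≠ 0`) this is
  `dec Lc (KPerf Lc sf sm (m+1)) = unitK rf⁻¹ rm⁻¹ (KPerf Lc sf sm m)` — «`≃units`» made explicit; the convergence of the MORE decimated
  (j, m)-family is DERIVED from that of the (j, m+1)-family inside (`tendsto_dec_apply`), not assumed;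
  `dec_KPerf_succ_of_decays`/`_of_decays_rate`: the same with the hypothesis in the cell's `Decays` all-scales / rate currencies
  (`HessKerDressedLimit.tendsto_limMKerOf_of_decays`, `tendsto_of_decays_rate`).
-/

namespace Summit.QuantumFields.BalabanUV.Beta.FP.StationarityK

open Filter Topology Finset
open scoped BigOperators
open Literature.MathematicalPhysics.QuantumFieldTheory.Balaban1983to89
open Literature.MathematicalPhysics.QuantumFieldTheory.Balaban1983to89.Beta
open ExpKernelCalculus (MKer Decays)
open HessKerRate (scaleK scaleK_apply)
open RateCertificate (CauchyRate)
open OneStepResolventKernel (Fib)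
open OneStepKernelFamily (dec legSet legPt legW)
open HessKerDressedLimit (limMKerOf limStOf limTabOf limMKerOf_apply limMKerOf_eq_of_tendsto tendsto_limMKerOf_of_decays
  tendsto_of_decays_rate)
open Summit.QuantumFields.BalabanUV.Beta.HessKerDressedUnits (legScale unitK unitK_apply)
open Summit.QuantumFields.BalabanUV.Beta.FP.PerfectObjects (KTot KTot_shift)
open Summit.QuantumFields.BalabanUV.Beta.FP.PerfectObjectsT (KPerf)

/-! ## §1 Index shift under the constructed limit (unconditional) -/

section Shift

variable {D : ℕ} {F : Type*}

/-- [folklore] The constructed limit of a real sequence ignores an index shift: `lim (j ↦ b (j + k)) = lim b` — for EVERY sequence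
(`limUnder` along `atTop`, and `map (· + k) atTop = atTop`); no convergence is needed. -/
theorem lim_add (b : ℕ → ℝ) (k : ℕ) : CauchyRate.lim (fun j => b (j + k)) = CauchyRate.lim b := by
  have h : Filter.map (fun j => b (j + k)) atTop = Filter.map b atTop := by
    rw [show (fun j => b (j + k)) = b ∘ (fun j => j + k) from rfl, ← Filter.map_map, Filter.map_add_atTop_eq_nat]
  simp only [RateCertificate.CauchyRate.lim, limUnder, h]

/-- [folklore] **INDEX SHIFT UNDER THE ENTRYWISE CONSTRUCTED LIMIT**: `limMKerOf (j ↦ K (j + k)) = limMKerOf K`, unconditionally. -/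
theorem limMKerOf_add (K : ℕ → MKer D F) (k : ℕ) : limMKerOf (fun j => K (j + k)) = limMKerOf K := by
  funext x y a b
  simp only [limMKerOf_apply]
  exact lim_add (fun j => K j x y a b) k

/-- [folklore] The shift by one: `limMKerOf (j ↦ K (j + 1)) = limMKerOf K`. -/
theorem limMKerOf_succ (K : ℕ → MKer D F) : limMKerOf (fun j => K (j + 1)) = limMKerOf K :=
  limMKerOf_add K 1

/-- [folklore] The shift by one for stencil-type tables. -/
theorem limStOf_succ {ι κ : Type*} (S : ℕ → ι → κ → MKer D F) : limStOf (fun j => S (j + 1)) = limStOf S := by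
  funext i u
  exact limMKerOf_succ fun j => S j i u

/-- [folklore] The shift by one for second-order tables. -/
theorem limTabOf_succ {ι₁ κ₁ ι₂ κ₂ : Type*} (W : ℕ → ι₁ → κ₁ → ι₂ → κ₂ → MKer D F) :
    limTabOf (fun j => W (j + 1)) = limTabOf W := by
  funext μ y ν y'
  exact limMKerOf_succ fun j => W j μ y ν y'

end Shift

/-! ## §2 Decimation versus units and versus entrywise limits -/

section Dec

variable {d : ℕ}

/-- [folklore] Block-contour decimation commutes with LEG-TYPE-dependent scalings (the weights and points of `dec` depend on the leg
only through its type, which the scaling does not move). -/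
theorem dec_scaleK (M : ℕ) (u v : Fib d → ℝ) (K : MKer (d + 1) (Fib d)) : dec M (scaleK u v K) = scaleK u v (dec M K) := by
  funext x' y' a b
  simp only [scaleK_apply, dec, Finset.mul_sum, Finset.sum_mul]
  exact Finset.sum_congr rfl fun i _ => Finset.sum_congr rfl fun i' _ => by ring

/-- [folklore] Block-contour decimation commutes with the leg units `unitK s_f s_m` (`= D K D`, `D = diag(s_f ∣ s_m)`). -/
theorem dec_unitK (M : ℕ) (sf sm : ℝ) (K : MKer (d + 1) (Fib d)) : dec M (unitK sf sm K) = unitK sf sm (dec M K) :=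
  dec_scaleK M _ _ K

/-- [folklore] Leg units are multiplicative legwise. -/
theorem legScale_mul (sf sm tf tm : ℝ) (a : Fib d) : legScale (sf * tf) (sm * tm) a = legScale sf sm a * legScale tf tm a := by
  cases a <;> rfl

/-- [folklore] Units compose: `unitK (s_f t_f) (s_m t_m) K = unitK t_f t_m (unitK s_f s_m K)`. -/
theorem unitK_mul (sf sm tf tm : ℝ) (K : MKer (d + 1) (Fib d)) : unitK (sf * tf) (sm * tm) K = unitK tf tm (unitK sf sm K) := by
  funext x y a b
  simp only [unitK_apply, legScale_mul]
  ring

/-- [folklore] **`dec` IS ENTRYWISE CONTINUOUS** (a finite weighted sum of entries): if every entry of `K j` converges to the corresponding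
entry of `Kinf`, every entry of `dec M (K j)` converges to that of `dec M Kinf`. -/
theorem tendsto_dec_apply {K : ℕ → MKer (d + 1) (Fib d)} {Kinf : MKer (d + 1) (Fib d)}
    (h : ∀ x y a b, Tendsto (fun j => K j x y a b) atTop (𝓝 (Kinf x y a b))) (M : ℕ) (x' y' : Fin (d + 1) → ℤ) (a b : Fib d) :
    Tendsto (fun j => dec M (K j) x' y' a b) atTop (𝓝 (dec M Kinf x' y' a b)) := by
  simp only [dec]
  exact tendsto_finsetSum _ fun i _ => tendsto_finsetSum _ fun i' _ => (h _ _ a b).const_mul _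

/-- [folklore] Hence the constructed limit of the decimated family IS the decimated limit (entrywise convergence to a named `Kinf`). -/
theorem limMKerOf_dec_of_tendsto {K : ℕ → MKer (d + 1) (Fib d)} {Kinf : MKer (d + 1) (Fib d)}
    (h : ∀ x y a b, Tendsto (fun j => K j x y a b) atTop (𝓝 (Kinf x y a b))) (M : ℕ) :
    limMKerOf (fun j => dec M (K j)) = dec M Kinf :=
  limMKerOf_eq_of_tendsto (tendsto_dec_apply h M)

/-- [folklore] **`dec` COMMUTES WITH THE CONSTRUCTED LIMIT OF A CONVERGENT FAMILY**: if every entry of `K j` converges (to something),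
`dec M (limMKerOf K) = limMKerOf (j ↦ dec M (K j))`.  (Without convergence the constructed limit is a junk value entry by entry and
nothing of the kind holds — the hypothesis is exactly X1m's output.) -/
theorem dec_limMKerOf_of_exists_tendsto {K : ℕ → MKer (d + 1) (Fib d)}
    (h : ∀ x y a b, ∃ L : ℝ, Tendsto (fun j => K j x y a b) atTop (𝓝 L)) (M : ℕ) :
    dec M (limMKerOf K) = limMKerOf (fun j => dec M (K j)) := by
  have h' : ∀ x y a b, Tendsto (fun j => K j x y a b) atTop (𝓝 (limMKerOf K x y a b)) := fun x y a b => by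
    rw [limMKerOf_apply]
    exact tendsto_nhds_limUnder (h x y a b)
  exact (limMKerOf_dec_of_tendsto h' M).symm

/-- [folklore] CONSTANT units pull out of the constructed limit of a convergent family. -/
theorem limMKerOf_unitK_of_exists_tendsto {K : ℕ → MKer (d + 1) (Fib d)}
    (h : ∀ x y a b, ∃ L : ℝ, Tendsto (fun j => K j x y a b) atTop (𝓝 L)) (tf tm : ℝ) :
    limMKerOf (fun j => unitK tf tm (K j)) = unitK tf tm (limMKerOf K) := by
  refine limMKerOf_eq_of_tendsto fun x y a b => ?_
  simp only [unitK_apply, limMKerOf_apply]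
  exact ((tendsto_nhds_limUnder (h x y a b)).const_mul _).mul_const _

end Dec

/-! ## §3 The fixed-point property of the perfect resolvents -/

section Perfect

variable {d : ℕ} (Lc : ℕ) [NeZero Lc] (sf sm : ℕ → ℝ) (m : ℕ)

/-- [our object] Unfolding of `KPerf … (m+1)` with the exponent written `j + m + 1` (definitional). -/
theorem KPerf_succ : KPerf (d := d) Lc sf sm (m + 1) = limMKerOf fun j => unitK (sf j) (sm j) (KTot (d := d) (Lc ^ (j + m + 1)) (Lc ^ j)) :=
  rfl

/-- [our object] One more `Lc`-decimation of the unit-rescaled (j, m+1)-resolvent is the unit-rescaled (j+1, m)-resolvent IN THE LEVEL-`j`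
UNITS (`dec_unitK` + `PerfectObjects.KTot_shift`). -/
theorem dec_unitK_KTot_shift (j : ℕ) :
    dec Lc (unitK (sf j) (sm j) (KTot (d := d) (Lc ^ (j + m + 1)) (Lc ^ j))) =
      unitK (sf j) (sm j) (KTot (d := d) (Lc ^ (j + m + 1)) (Lc ^ (j + 1))) := by
  rw [dec_unitK, KTot_shift]

/-- **THE FIXED-POINT PROPERTY, SHIFTED-UNITS FORM.**  Under ENTRYWISE CONVERGENCE of the unit-rescaled (j, m+1)-family (X1m), one more
`Lc`-decimation of the perfect `(m+1)`-fold resolvent IS the perfect `m`-fold resolvent read in the once-shifted units: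
`dec Lc (KPerf Lc sf sm (m+1)) = KPerf Lc (i ↦ sf (i−1)) (i ↦ sm (i−1)) m`. [our object] -/
theorem dec_KPerf_succ
    (hconv : ∀ x y a b, ∃ L : ℝ, Tendsto (fun j => unitK (sf j) (sm j) (KTot (d := d) (Lc ^ (j + m + 1)) (Lc ^ j)) x y a b) atTop (𝓝 L)) :
    dec Lc (KPerf (d := d) Lc sf sm (m + 1)) = KPerf Lc (fun i => sf (i - 1)) (fun i => sm (i - 1)) m := by
  rw [KPerf_succ, dec_limMKerOf_of_exists_tendsto hconv, KPerf,
    ← limMKerOf_succ (fun i => unitK (sf (i - 1)) (sm (i - 1)) (KTot (d := d) (Lc ^ (i + m)) (Lc ^ i)))]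
  congr 1
  funext j
  rw [dec_unitK_KTot_shift, Nat.add_sub_cancel, Nat.add_right_comm j 1 m]

variable {Lc sf sm m}

/-- [folklore] For GEOMETRIC units the once-shifted units differ from the original ones by the constant factors `rf⁻¹, rm⁻¹` from index `1` on. -/
theorem unitK_shift_of_geometric {rf rm : ℝ} (hrf : rf ≠ 0) (hrm : rm ≠ 0) (hf : ∀ j, sf (j + 1) = rf * sf j)
    (hm : ∀ j, sm (j + 1) = rm * sm j) (j : ℕ) (K : MKer (d + 1) (Fib d)) :
    unitK (sf j) (sm j) K = unitK rf⁻¹ rm⁻¹ (unitK (sf (j + 1)) (sm (j + 1)) K) := by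
  rw [← unitK_mul, hf j, hm j, mul_right_comm rf (sf j) rf⁻¹, mul_inv_cancel₀ hrf, one_mul, mul_right_comm rm (sm j) rm⁻¹,
    mul_inv_cancel₀ hrm, one_mul]

/-- **THE FIXED-POINT PROPERTY OF THE PERFECT RESOLVENTS («`dec Lc (KPerf (m+1)) ≃units KPerf m`»).**  For GEOMETRIC units
`sf (j+1) = rf·sf j`, `sm (j+1) = rm·sm j` (`rf, rm ≠ 0`) and under ENTRYWISE CONVERGENCE of the unit-rescaled (j, m+1)-family (X1m):
`dec Lc (KPerf Lc sf sm (m+1)) = unitK rf⁻¹ rm⁻¹ (KPerf Lc sf sm m)`.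
The convergence of the (more decimated) (j, m)-family is DERIVED inside from that of the (j, m+1)-family (`tendsto_dec_apply`). [our object] -/
theorem dec_KPerf_succ_of_geometric {rf rm : ℝ} (hrf : rf ≠ 0) (hrm : rm ≠ 0) (hf : ∀ j, sf (j + 1) = rf * sf j)
    (hm : ∀ j, sm (j + 1) = rm * sm j)
    (hconv : ∀ x y a b, ∃ L : ℝ, Tendsto (fun j => unitK (sf j) (sm j) (KTot (d := d) (Lc ^ (j + m + 1)) (Lc ^ j)) x y a b) atTop (𝓝 L)) :
    dec Lc (KPerf (d := d) Lc sf sm (m + 1)) = unitK rf⁻¹ rm⁻¹ (KPerf Lc sf sm m) := by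
  -- the decimated (j, m+1)-family = the (j+1, m)-family in the constant-shifted level-(j+1) units
  have hshift : ∀ j, dec Lc (unitK (sf j) (sm j) (KTot (d := d) (Lc ^ (j + m + 1)) (Lc ^ j))) =
      unitK rf⁻¹ rm⁻¹ (unitK (sf (j + 1)) (sm (j + 1)) (KTot (d := d) (Lc ^ (j + 1 + m)) (Lc ^ (j + 1)))) := fun j => by
    rw [dec_unitK_KTot_shift, Nat.add_right_comm j 1 m, unitK_shift_of_geometric hrf hrm hf hm]
  -- entrywise convergence of the decimated family (finite sums), hence of the (j+1, m)-family
  have hconv' : ∀ x y a b, ∃ L : ℝ,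
      Tendsto (fun j => unitK (sf (j + 1)) (sm (j + 1)) (KTot (d := d) (Lc ^ (j + 1 + m)) (Lc ^ (j + 1))) x y a b) atTop (𝓝 L) := by
    intro x y a b
    have hK : ∀ x y a b, Tendsto (fun j => unitK (sf j) (sm j) (KTot (d := d) (Lc ^ (j + m + 1)) (Lc ^ j)) x y a b) atTop
        (𝓝 (limMKerOf (fun j => unitK (sf j) (sm j) (KTot (d := d) (Lc ^ (j + m + 1)) (Lc ^ j))) x y a b)) := fun x y a b => by
      rw [limMKerOf_apply]; exact tendsto_nhds_limUnder (hconv x y a b)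
    have hdec := tendsto_dec_apply hK Lc x y a b
    simp only [hshift] at hdec
    -- undo the constant units `rf⁻¹, rm⁻¹`
    refine ⟨legScale rf rm a * (dec Lc (limMKerOf fun j => unitK (sf j) (sm j) (KTot (d := d) (Lc ^ (j + m + 1)) (Lc ^ j))) x y a b) *
      legScale rf rm b, ?_⟩
    have h2 := (hdec.const_mul (legScale (d := d) rf rm a)).mul_const (legScale (d := d) rf rm b)
    refine h2.congr' (Eventually.of_forall fun j => ?_)
    simp only [unitK_apply]
    have ha : legScale (d := d) rf rm a * legScale rf⁻¹ rm⁻¹ a = 1 :=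
      Summit.QuantumFields.BalabanUV.Beta.HessKerDressedUnits.legScale_mul_legScale_inv hrf hrm a
    have hb : legScale (d := d) rf rm b * legScale rf⁻¹ rm⁻¹ b = 1 :=
      Summit.QuantumFields.BalabanUV.Beta.HessKerDressedUnits.legScale_mul_legScale_inv hrf hrm b
    calc legScale rf rm a * (legScale rf⁻¹ rm⁻¹ a *
            (legScale (sf (j + 1)) (sm (j + 1)) a * KTot (Lc ^ (j + 1 + m)) (Lc ^ (j + 1)) x y a b * legScale (sf (j + 1)) (sm (j + 1)) b) *
            legScale rf⁻¹ rm⁻¹ b) * legScale rf rm b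
        = (legScale rf rm a * legScale rf⁻¹ rm⁻¹ a) *
            (legScale (sf (j + 1)) (sm (j + 1)) a * KTot (Lc ^ (j + 1 + m)) (Lc ^ (j + 1)) x y a b * legScale (sf (j + 1)) (sm (j + 1)) b) *
            (legScale rf rm b * legScale rf⁻¹ rm⁻¹ b) := by ring
      _ = _ := by rw [ha, hb, one_mul, mul_one]
  rw [KPerf_succ, dec_limMKerOf_of_exists_tendsto hconv, KPerf]
  simp only [hshift]
  rw [limMKerOf_unitK_of_exists_tendsto hconv',
    limMKerOf_succ (fun i => unitK (sf i) (sm i) (KTot (d := d) (Lc ^ (i + m)) (Lc ^ i)))]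

/-- **THE FIXED-POINT PROPERTY, `Decays` ALL-SCALES CURRENCY**: the convergence hypothesis supplied as the cell's all-scales deviation bound
`Decays (K (k+j) − K k) (c θ^k) δ`, `θ < 1`, for the unit-rescaled (j, m+1)-family `K` (`HessKerDressedLimit.tendsto_limMKerOf_of_decays`). [our object] -/
theorem dec_KPerf_succ_of_decays {rf rm c δ θ : ℝ} (hrf : rf ≠ 0) (hrm : rm ≠ 0) (hf : ∀ j, sf (j + 1) = rf * sf j)
    (hm : ∀ j, sm (j + 1) = rm * sm j)
    (hKall : ∀ k j, Decays (unitK (sf (k + j)) (sm (k + j)) (KTot (d := d) (Lc ^ (k + j + m + 1)) (Lc ^ (k + j))) -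
      unitK (sf k) (sm k) (KTot (d := d) (Lc ^ (k + m + 1)) (Lc ^ k))) (c * θ ^ k) δ) (hθ1 : θ < 1) :
    dec Lc (KPerf (d := d) Lc sf sm (m + 1)) = unitK rf⁻¹ rm⁻¹ (KPerf Lc sf sm m) :=
  dec_KPerf_succ_of_geometric hrf hrm hf hm fun x y a b =>
    ⟨_, tendsto_limMKerOf_of_decays (K := fun j => unitK (sf j) (sm j) (KTot (d := d) (Lc ^ (j + m + 1)) (Lc ^ j))) hKall hθ1 x y a b⟩

/-- **THE FIXED-POINT PROPERTY, RATE-TO-A-NAMED-LIMIT CURRENCY**: the convergence hypothesis supplied as `Decays`-rate data of the unit-rescaled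
(j, m+1)-family to ANY named kernel `Kinf` (`0 ≤ θ < 1`; `HessKerDressedLimit.tendsto_of_decays_rate`). [our object] -/
theorem dec_KPerf_succ_of_decays_rate {Kinf : MKer (d + 1) (Fib d)} {rf rm c δ θ : ℝ} (hrf : rf ≠ 0) (hrm : rm ≠ 0)
    (hf : ∀ j, sf (j + 1) = rf * sf j) (hm : ∀ j, sm (j + 1) = rm * sm j)
    (hrate : ∀ k, Decays (unitK (sf k) (sm k) (KTot (d := d) (Lc ^ (k + m + 1)) (Lc ^ k)) - Kinf) (c * θ ^ k) δ)
    (hθ0 : 0 ≤ θ) (hθ1 : θ < 1) :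
    dec Lc (KPerf (d := d) Lc sf sm (m + 1)) = unitK rf⁻¹ rm⁻¹ (KPerf Lc sf sm m) :=
  dec_KPerf_succ_of_geometric hrf hrm hf hm fun x y a b => ⟨_, tendsto_of_decays_rate hrate hθ0 hθ1 x y a b⟩

end Perfect

end Summit.QuantumFields.BalabanUV.Beta.FP.StationarityK

/-! ## §4 (v1.1, APPEND-ONLY) The ITERATED fixed-point property — `k` more decimations of the perfect `(m+k)`-fold resolvent give the
perfect `m`-fold resolvent in the `k`-times shifted units — and the ADOPTED units `(Lc^j, Lc^{j(d+1)})` of the (CONV-C) K-slot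
(`GAN24.CombesThomas.sfStep/smStep`, written out here as `fun j => (Lc:ℝ)^j`, `fun j => (Lc:ℝ)^(j*(d+1))` so that no import is added;
both unfold by `rfl`).  In particular `dec (Lc^k) (KPerf … (1+k)) ≃units KPerf … 1` = road A2's constructed one-step limit `K∞`
(`PerfectObjectsT.KPerf_one`): the K-half of «`TPerf Lc m` is ONE perfect step with blocking `Lc^m`» (skeleton §3 N1), at the limit. -/

namespace Summit.QuantumFields.BalabanUV.Beta.FP.StationarityK

open Filter Topology
open Literature.MathematicalPhysics.QuantumFieldTheory.Balaban1983to89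
open Literature.MathematicalPhysics.QuantumFieldTheory.Balaban1983to89.Beta
open ExpKernelCalculus (MKer Decays)
open OneStepResolventKernel (Fib)
open OneStepKernelFamily (dec)
open HessKerDressedLimit (limMKerOf)
open Summit.QuantumFields.BalabanUV.Beta.HessKerDressedUnits (unitK unitK_one)
open Summit.QuantumFields.BalabanUV.Beta.GAN24.ScaleNesting (dec_dec)
open Summit.QuantumFields.BalabanUV.Beta.FP.PerfectObjects (KTot)
open Summit.QuantumFields.BalabanUV.Beta.FP.PerfectObjectsT (KPerf)

section Iterate

variable {d : ℕ} {Lc : ℕ} [NeZero Lc] {sf sm : ℕ → ℝ}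

/-- **THE ITERATED FIXED-POINT PROPERTY.**  For GEOMETRIC units (`sf (j+1) = rf·sf j`, `sm (j+1) = rm·sm j`, `rf, rm ≠ 0`) and under ENTRYWISE
CONVERGENCE of the unit-rescaled (j, m+i+1)-families for `i < k` (X1m):
`dec (Lc^k) (KPerf Lc sf sm (m+k)) = unitK (rf⁻¹)^k (rm⁻¹)^k (KPerf Lc sf sm m)`
(induction on `k`: `dec_one`, `ScaleNesting.dec_dec`, `dec_KPerf_succ_of_geometric`, `dec_unitK`, `unitK_mul`). [our object] -/
theorem dec_pow_KPerf_add_of_geometric {rf rm : ℝ} (hrf : rf ≠ 0) (hrm : rm ≠ 0) (hf : ∀ j, sf (j + 1) = rf * sf j)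
    (hm : ∀ j, sm (j + 1) = rm * sm j) (m k : ℕ)
    (hconv : ∀ i, i < k → ∀ x y a b, ∃ L : ℝ,
      Tendsto (fun j => unitK (sf j) (sm j) (KTot (d := d) (Lc ^ (j + (m + i) + 1)) (Lc ^ j)) x y a b) atTop (𝓝 L)) :
    dec (Lc ^ k) (KPerf (d := d) Lc sf sm (m + k)) = unitK (rf⁻¹ ^ k) (rm⁻¹ ^ k) (KPerf Lc sf sm m) := by
  induction k with
  | zero =>
      show dec (Lc ^ 0) (KPerf (d := d) Lc sf sm m) = unitK (rf⁻¹ ^ 0) (rm⁻¹ ^ 0) (KPerf Lc sf sm m)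
      rw [pow_zero, pow_zero, pow_zero, unitK_one]
      exact HessianTelescopingKKT.dec_one _
  | succ k ih =>
      have hk : dec (Lc ^ k) (KPerf (d := d) Lc sf sm (m + k)) = unitK (rf⁻¹ ^ k) (rm⁻¹ ^ k) (KPerf Lc sf sm m) :=
        ih fun i hi => hconv i (Nat.lt_succ_of_lt hi)
      have hstep : dec Lc (KPerf (d := d) Lc sf sm (m + k + 1)) = unitK rf⁻¹ rm⁻¹ (KPerf Lc sf sm (m + k)) :=
        dec_KPerf_succ_of_geometric hrf hrm hf hm (hconv k (Nat.lt_succ_self k))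
      show dec (Lc ^ (k + 1)) (KPerf (d := d) Lc sf sm (m + k + 1)) = _
      rw [pow_succ', ← dec_dec Lc (Lc ^ k), hstep, dec_unitK, hk, ← unitK_mul, ← pow_succ, ← pow_succ]

/-- **DOWN TO ROAD A2's ONE-STEP LIMIT**: `dec (Lc^k) (KPerf … (1+k)) = unitK (rf⁻¹)^k (rm⁻¹)^k (KPerf … 1)`, and `KPerf … 1` is road A2's constructed
limit `limMKerOf (j ↦ unitK (sf j) (sm j) (KInvStep Lc j))` (`PerfectObjectsT.KPerf_one`, `rfl`) — the perfect `(k+1)`-fold resolvent, decimated `k` more times,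
IS the perfect one-step resolvent up to units. [our object] -/
theorem dec_pow_KPerf_one_add_of_geometric {rf rm : ℝ} (hrf : rf ≠ 0) (hrm : rm ≠ 0) (hf : ∀ j, sf (j + 1) = rf * sf j)
    (hm : ∀ j, sm (j + 1) = rm * sm j) (k : ℕ)
    (hconv : ∀ i, i < k → ∀ x y a b, ∃ L : ℝ,
      Tendsto (fun j => unitK (sf j) (sm j) (KTot (d := d) (Lc ^ (j + (1 + i) + 1)) (Lc ^ j)) x y a b) atTop (𝓝 L)) :
    dec (Lc ^ k) (KPerf (d := d) Lc sf sm (1 + k)) =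
      unitK (rf⁻¹ ^ k) (rm⁻¹ ^ k) (limMKerOf fun j => unitK (sf j) (sm j) (OneStepKernelFamily.KInvStep (d := d) Lc j)) :=
  dec_pow_KPerf_add_of_geometric hrf hrm hf hm 1 k hconv

end Iterate

/-! ### The adopted units `s_f j = Lc^j`, `s_m j = Lc^{j(d+1)}` (= `GAN24.CombesThomas.sfStep Lc`, `smStep d Lc` by `rfl`) -/

section Adopted

variable {d : ℕ} {Lc : ℕ} [NeZero Lc]

/-- [folklore] The adopted field-leg unit is geometric with ratio `Lc`. -/
theorem adopted_sf_succ (Lc : ℕ) (j : ℕ) : (fun j : ℕ => ((Lc : ℝ)) ^ j) (j + 1) = (Lc : ℝ) * (fun j : ℕ => ((Lc : ℝ)) ^ j) j := by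
  simp only [pow_succ']

/-- [folklore] The adopted multiplier-leg unit is geometric with ratio `Lc^{d+1}`. -/
theorem adopted_sm_succ (d Lc : ℕ) (j : ℕ) :
    (fun j : ℕ => ((Lc : ℝ)) ^ (j * (d + 1))) (j + 1) = (Lc : ℝ) ^ (d + 1) * (fun j : ℕ => ((Lc : ℝ)) ^ (j * (d + 1))) j := by
  show (Lc : ℝ) ^ ((j + 1) * (d + 1)) = (Lc : ℝ) ^ (d + 1) * (Lc : ℝ) ^ (j * (d + 1))
  rw [add_one_mul, pow_add, mul_comm]

/-- **THE FIXED-POINT PROPERTY IN THE ADOPTED UNITS** `(Lc^j, Lc^{j(d+1)})`: under entrywise convergence of the unit-normalised (j, m+1)-family,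
`dec Lc (KPerf … (m+1)) = unitK (Lc:ℝ)⁻¹ ((Lc:ℝ)^(d+1))⁻¹ (KPerf … m)` — one `Lc`-decimation costs exactly the one-step unit `diag(Lc⁻¹ ∣ Lc^{−(d+1)})`. [our object] -/
theorem dec_KPerf_succ_adopted (m : ℕ)
    (hconv : ∀ x y a b, ∃ L : ℝ, Tendsto (fun j => unitK ((Lc : ℝ) ^ j) ((Lc : ℝ) ^ (j * (d + 1)))
      (KTot (d := d) (Lc ^ (j + m + 1)) (Lc ^ j)) x y a b) atTop (𝓝 L)) :
    dec Lc (KPerf (d := d) Lc (fun j => (Lc : ℝ) ^ j) (fun j => (Lc : ℝ) ^ (j * (d + 1))) (m + 1)) =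
      unitK ((Lc : ℝ))⁻¹ ((Lc : ℝ) ^ (d + 1))⁻¹ (KPerf Lc (fun j => (Lc : ℝ) ^ j) (fun j => (Lc : ℝ) ^ (j * (d + 1))) m) :=
  have hLc : (Lc : ℝ) ≠ 0 := Nat.cast_ne_zero.2 (NeZero.ne Lc)
  dec_KPerf_succ_of_geometric hLc (pow_ne_zero _ hLc) (adopted_sf_succ Lc) (adopted_sm_succ d Lc) hconv

/-- **THE ITERATED FIXED-POINT PROPERTY IN THE ADOPTED UNITS**: `dec (Lc^k) (KPerf … (m+k)) = unitK (Lc⁻¹)^k ((Lc^{d+1})⁻¹)^k (KPerf … m)`. [our object] -/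
theorem dec_pow_KPerf_add_adopted (m k : ℕ)
    (hconv : ∀ i, i < k → ∀ x y a b, ∃ L : ℝ, Tendsto (fun j => unitK ((Lc : ℝ) ^ j) ((Lc : ℝ) ^ (j * (d + 1)))
      (KTot (d := d) (Lc ^ (j + (m + i) + 1)) (Lc ^ j)) x y a b) atTop (𝓝 L)) :
    dec (Lc ^ k) (KPerf (d := d) Lc (fun j => (Lc : ℝ) ^ j) (fun j => (Lc : ℝ) ^ (j * (d + 1))) (m + k)) =
      unitK (((Lc : ℝ))⁻¹ ^ k) (((Lc : ℝ) ^ (d + 1))⁻¹ ^ k) (KPerf Lc (fun j => (Lc : ℝ) ^ j) (fun j => (Lc : ℝ) ^ (j * (d + 1))) m) :=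
  have hLc : (Lc : ℝ) ≠ 0 := Nat.cast_ne_zero.2 (NeZero.ne Lc)
  dec_pow_KPerf_add_of_geometric hLc (pow_ne_zero _ hLc) (adopted_sf_succ Lc) (adopted_sm_succ d Lc) m k hconv

end Adopted

end Summit.QuantumFields.BalabanUV.Beta.FP.StationarityK
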